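import Summits.CriticalPhenomena.PercolationContinuityZ3.Theorems.PercNearOneGluingAdditiveGluingBlockMultiEdgeSplit
import Summits.CriticalPhenomena.PercolationContinuityZ3.Theorems.PercNearOneGluingAdditiveGluingAL5RestrictedLemma3
import Summits.CriticalPhenomena.PercolationContinuityZ3.Theorems.PercNearOneGluingAdditiveGluingGluePushforward
import Literature.Probability.Percolation.KozmaNitzanPreFKG
import HarnessLib

/-! # Crux `PercNearOneGluing.AdditiveGluing` (stmt-CriticalPhenomena-4576) — PEELING one contact relay of a glued block:
# the relay-by-relay reduction of the finger multi-edge Lemma 3 (seat (b) V⁺-form, depth prover `png-dp-vplus`)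

Support file (`--supports stmt-CriticalPhenomena-4576`); no definitions, no named facts.  Companion of
`…AdditiveGluingBlockMultiEdgeSplit.lean` (`contact_split`) and of the registered open stub `stub_fingerML3_vp`
(`…AdditiveGluingTFingers.lean`).

`μ_p = prodBernoulli p` on the bond configurations of `Fin n`; a block `N`, a relay `a ∉ N` with contact pairs
`F_a = {s(v,a) : v ∈ …} ` (`v ∈ N`), `R_a` = "some pair of `F_a` is open", `U = ⋃_{s∈N}{s ↔ b}`, `d ∉ N`, `d ≠ a`, and the
DECREASING event `M = {d ↮ N}` ("the cluster of `d` avoids the block").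

* `contactRelay_exchange` — for ANY weighting `p`: the restricted comparison `μ_p(M ∩ {d↔b}) ≤ μ_p(M ∩ {a↔b})` implies
  `μ_p(R_a ∩ {d↔b}) ≤ μ_p(R_a ∩ U)`.  Proof: the restricted Kozma–Nitzan Lemma 3(i) (`knLemma3i_restricted`, restriction on the
  cluster of the WEAK vertex `d`, event `R_a` increasing and determined by `C_a`) gives `μ(M, d↔b, R_a) ≤ μ(M, a↔b, R_a) ≤ μ(M, U, R_a)`
  (on `R_a` the relay `a` is attached to the block); off `M` the vertex `d` is attached to the block, so `{d↔b} ⊆ U` there.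
* `glue_restricted_of_unglued` — if `g = K/N` glues the block then `μ_K(d↔b) ≤ μ_K(a↔b)` (UNGLUED comparison) implies
  `μ_g(M ∩ {d↔b}) ≤ μ_g(M ∩ {a↔b})`: Kozma–Nitzan Lemma 3(ii) (`KozmaNitzan2024_lemma3_ii_notConn`, decreasing event `M` read on
  the weak cluster) in `K`, then the gluing push-forward (`stub_gluePushforward`): on `M` the cluster of `d` does not feel the
  gluing (`reachable_of_glue_of_avoids`), while `{a↔b}` only grows.
* `block_multiEdge_peel` — **the peeling step**: `F = F₁ ∪ F_a`; if `μ_g(M ∩ {d↔b}) ≤ μ_g(M ∩ {a↔b})` and the multi-edge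
  conclusion holds for the remaining contacts `F₁` in the weighting `g ⊖ F_a` (pairs of `F_a` killed), then it holds for `F` in `g`
  (`contact_split` over `F_a` + `contactRelay_exchange`).
So the unglued hypothesis of `stub_fingerML3_vp` at ONE relay `a` pays for removing the contacts at `a`; iterating needs the
hypothesis in the reduced weighting (designation drift), see `…AdditiveGluingFingerPeel.lean` for the classes this settles.
[cite: KozmaNitzan2024, Lemma 3(i)–(ii) (pp. 6–7), Lemma 5 (p. 13), §3.1 (gluing), §3.2 pp. 12–14]
[cite: VandenbergHaggstromKahn2005, Thms. 1.3–1.5 (pp. 6–8)]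
-/

namespace Summit.CriticalPhenomena.PercolationContinuityZ3.Theorems

open MeasureTheory Set
open Literature.Probability.LatticeModels (prodBernoulli)
open Literature.Probability.Percolation (BondConfig openConn openGraph openEdgeCluster pinW localCylinder
  DeterminedBy determinedBy_iff)

noncomputable section
open Classical

section BlockPeel

open Literature.Probability.LatticeModels Literature.Probability.Percolation

variable {n : ℕ}

/-! ### The exchange at one contact relay, from the restricted comparison -/

/-- "Some contact pair at `a` is open" is increasing and determined by the open edge cluster of `a`: an open non-loop pair
`s(v,a)` belongs to `C_a`. [folklore; VandenbergHaggstromKahn2005 §1] -/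
theorem contactRelay_R_mono (N : Finset (Fin n)) (Fa : Finset (Sym2 (Fin n))) (a : Fin n)
    (hFa : ∀ e ∈ Fa, ∃ v ∈ N, e = s(v, a)) (haN : a ∉ N) :
    ∀ ω ω' : BondConfig (Fin n), ω ∈ {ω : Set (Sym2 (Fin n)) | ∃ e ∈ Fa, e ∈ ω} →
      openEdgeCluster ω a ⊆ openEdgeCluster ω' a → ω' ∈ {ω : Set (Sym2 (Fin n)) | ∃ e ∈ Fa, e ∈ ω} := by
  intro ω ω' hω hsub
  obtain ⟨e, heF, heω⟩ := hω
  obtain ⟨v, hvN, rfl⟩ := hFa e heF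
  have hva : v ≠ a := fun h => haN (h ▸ hvN)
  have hmem : s(v, a) ∈ openEdgeCluster ω a := by
    rw [mem_openEdgeCluster_iff]
    refine ⟨heω, fun h => hva (Sym2.mk_isDiag_iff.1 h), fun x hx => ?_⟩
    rcases Sym2.mem_iff.1 hx with rfl | rfl
    · have hav : (openGraph ω).Adj a x := (openGraph_adj ω a x).2 ⟨by rw [Sym2.eq_swap]; exact heω, hva.symm⟩
      exact hav.reachable
    · exact SimpleGraph.Reachable.refl _
  exact ⟨s(v, a), heF, openEdgeCluster_subset ω' a (hsub hmem)⟩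

/-- **Exchange at one contact relay.**  Any weighting `p`; block `N`, relay `a ∉ N` with contact pairs `F_a` (pairs `s(v,a)`, `v ∈ N`),
`d ∉ N`, `d ≠ a`, `M = {d ↮ N}`.  If `μ_p(M ∩ {d↔b}) ≤ μ_p(M ∩ {a↔b})` then `μ_p(R_a ∩ {d↔b}) ≤ μ_p(R_a ∩ ⋃_{s∈N}{s↔b})`.
(Restricted KN Lemma 3(i) on `M` with `Q = R_a`; on `R_a`, `{a↔b} ⊆ ⋃_s{s↔b}`; off `M`, `{d↔b} ⊆ ⋃_s{s↔b}`.)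
[cite: KozmaNitzan2024, Lemma 3(i) (pp. 6–7)] [cite: VandenbergHaggstromKahn2005, Thms. 1.3–1.5] -/
theorem contactRelay_exchange (p : Sym2 (Fin n) → unitInterval) (N : Finset (Fin n)) (Fa : Finset (Sym2 (Fin n)))
    (a d b : Fin n) (hFa : ∀ e ∈ Fa, ∃ v ∈ N, e = s(v, a)) (haN : a ∉ N) (hdN : d ∉ N) (hda : d ≠ a)
    (hrestr : (prodBernoulli p).real
        ({ω : BondConfig (Fin n) | ∀ x ∈ (↑N : Set (Fin n)), ¬ (openGraph ω).Reachable d x} ∩ openConn d b) ≤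
      (prodBernoulli p).real
        ({ω : BondConfig (Fin n) | ∀ x ∈ (↑N : Set (Fin n)), ¬ (openGraph ω).Reachable d x} ∩ openConn a b)) :
    (prodBernoulli p).real ({ω : Set (Sym2 (Fin n)) | ∃ e ∈ Fa, e ∈ ω} ∩ openConn d b) ≤
      (prodBernoulli p).real ({ω : Set (Sym2 (Fin n)) | ∃ e ∈ Fa, e ∈ ω} ∩ ⋃ s ∈ N, openConn s b) := by
  set M : Set (BondConfig (Fin n)) :=
    {ω : BondConfig (Fin n) | ∀ x ∈ (↑N : Set (Fin n)), ¬ (openGraph ω).Reachable d x} with hM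
  set R : Set (BondConfig (Fin n)) := {ω : Set (Sym2 (Fin n)) | ∃ e ∈ Fa, e ∈ ω} with hR
  set U : Set (BondConfig (Fin n)) := ⋃ s ∈ N, openConn s b with hU
  have hmeas : ∀ s : Set (BondConfig (Fin n)), MeasurableSet s := fun _ => MeasurableSet.of_discrete
  have hdN' : d ∉ (↑N : Set (Fin n)) := fun h => hdN (Finset.mem_coe.1 h)
  -- restricted Lemma 3(i) with `Q = R_a`
  have h3 := knLemma3i_restricted p d a b (↑N : Set (Fin n)) hdN' hda R 0
    (contactRelay_R_mono N Fa a hFa haN) le_rfl (by rw [add_zero]; exact hrestr)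
  rw [add_zero] at h3
  -- split both sides along `M`
  have hs1 := measureReal_inter_add_sdiff (μ := prodBernoulli p) (s := R ∩ openConn d b) (hmeas M)
  have hs2 := measureReal_inter_add_sdiff (μ := prodBernoulli p) (s := R ∩ U) (hmeas M)
  have e1 : (R ∩ openConn d b) ∩ M = M ∩ openConn d b ∩ R := by
    ext ω; simp only [Set.mem_inter_iff]; tauto
  have hA : (prodBernoulli p).real (M ∩ openConn a b ∩ R) ≤ (prodBernoulli p).real ((R ∩ U) ∩ M) := by
    refine measureReal_mono ?_
    rintro ω ⟨⟨hωM, hab⟩, hωR⟩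
    obtain ⟨e, heF, heω⟩ := hωR
    obtain ⟨v, hvN, rfl⟩ := hFa e heF
    have hva : v ≠ a := fun h => haN (h ▸ hvN)
    refine ⟨⟨⟨s(v, a), heF, heω⟩, Set.mem_iUnion₂.2 ⟨v, hvN, ?_⟩⟩, hωM⟩
    have hadj : (openGraph ω).Adj v a := (openGraph_adj ω v a).2 ⟨heω, hva⟩
    exact hadj.reachable.trans hab
  have hB : (prodBernoulli p).real ((R ∩ openConn d b) \ M) ≤ (prodBernoulli p).real ((R ∩ U) \ M) := by
    refine measureReal_mono ?_
    rintro ω ⟨⟨hωR, hdb⟩, hωM⟩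
    refine ⟨⟨hωR, ?_⟩, hωM⟩
    have : ∃ x ∈ (↑N : Set (Fin n)), (openGraph ω).Reachable d x := by
      by_contra hcon
      push Not at hcon
      exact hωM hcon
    obtain ⟨x, hxN, hdx⟩ := this
    have hdb' : (openGraph ω).Reachable d b := hdb
    exact Set.mem_iUnion₂.2 ⟨x, Finset.mem_coe.1 hxN, hdx.symm.trans hdb'⟩
  rw [e1] at hs1
  linarith

/-! ### The restricted comparison in the glued weighting, from the unglued comparison -/

/-- If the cluster of `d` avoids the block `N` in `ω`, then every vertex reachable from `d` after GLUING `N` (adding all non-loop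
pairs inside `N`) is already reachable from `d` in `ω`: a walk from `d` cannot enter the glued clique without first reaching a
vertex of `N` along open pairs of `ω`. [folklore] -/
theorem reachable_of_glue_of_avoids {ω : BondConfig (Fin n)} {N : Finset (Fin n)} {d : Fin n}
    (hM : ∀ x ∈ (↑N : Set (Fin n)), ¬ (openGraph ω).Reachable d x) {y : Fin n}
    (h : (openGraph (ω ∪ {e : Sym2 (Fin n) | (∀ x ∈ e, x ∈ N) ∧ ¬ e.IsDiag} : BondConfig (Fin n))).Reachable d y) :
    (openGraph ω).Reachable d y := by
  obtain ⟨p⟩ := h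
  suffices key : ∀ (u v : Fin n)
      (q : (openGraph (ω ∪ {e : Sym2 (Fin n) | (∀ x ∈ e, x ∈ N) ∧ ¬ e.IsDiag} : BondConfig (Fin n))).Walk u v),
      (openGraph ω).Reachable d u → (openGraph ω).Reachable d v from key d y p (SimpleGraph.Reachable.refl _)
  intro u v q
  induction q with
  | nil => exact id
  | cons hadj q ih =>
    intro hu
    refine ih ?_
    rename_i u' w' _
    obtain ⟨hmem, hne⟩ := (openGraph_adj _ u' w').1 hadj
    rcases hmem with hω | hD
    · exact hu.trans ((openGraph_adj ω u' w').2 ⟨hω, hne⟩).reachable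
    · exact (hM u' (Finset.mem_coe.2 (hD.1 u' (Sym2.mem_mk_left u' w'))) hu).elim

/-- Reachability only grows under gluing. [folklore] -/
theorem reachable_glue_mono {ω : BondConfig (Fin n)} (N : Finset (Fin n)) {x y : Fin n}
    (h : (openGraph ω).Reachable x y) :
    (openGraph (ω ∪ {e : Sym2 (Fin n) | (∀ x ∈ e, x ∈ N) ∧ ¬ e.IsDiag} : BondConfig (Fin n))).Reachable x y :=
  h.mono (SimpleGraph.fromEdgeSet_mono Set.subset_union_left)

/-- On `M = {d ↮ N}` gluing the block does not change `{d ↔ b}`: the pull-back of `M ∩ {d↔b}` under `ω ↦ ω ∪ clique(N)` is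
`M ∩ {d↔b}`. [folklore] -/
theorem glue_preimage_avoids_inter_openConn (N : Finset (Fin n)) (d b : Fin n) :
    {ω : BondConfig (Fin n) | (ω ∪ {e : Sym2 (Fin n) | (∀ x ∈ e, x ∈ N) ∧ ¬ e.IsDiag} : BondConfig (Fin n)) ∈
        ({ω : BondConfig (Fin n) | ∀ x ∈ (↑N : Set (Fin n)), ¬ (openGraph ω).Reachable d x} ∩ openConn d b)} =
      {ω : BondConfig (Fin n) | ∀ x ∈ (↑N : Set (Fin n)), ¬ (openGraph ω).Reachable d x} ∩ openConn d b := by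
  ext ω
  simp only [Set.mem_setOf_eq, Set.mem_inter_iff]
  constructor
  · rintro ⟨hM', hdb'⟩
    have hM : ∀ x ∈ (↑N : Set (Fin n)), ¬ (openGraph ω).Reachable d x :=
      fun x hx hdx => hM' x hx (reachable_glue_mono N hdx)
    exact ⟨hM, reachable_of_glue_of_avoids hM hdb'⟩
  · rintro ⟨hM, hdb⟩
    refine ⟨fun x hx hdx => hM x hx (reachable_of_glue_of_avoids hM hdx), ?_⟩
    exact reachable_glue_mono N (show (openGraph ω).Reachable d b from hdb)

/-- The pull-back of `M ∩ {a↔b}` under gluing contains `M ∩ {a↔b}`. [folklore] -/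
theorem glue_preimage_avoids_inter_openConn_superset (N : Finset (Fin n)) (d a b : Fin n) :
    {ω : BondConfig (Fin n) | ∀ x ∈ (↑N : Set (Fin n)), ¬ (openGraph ω).Reachable d x} ∩ openConn a b ⊆
      {ω : BondConfig (Fin n) | (ω ∪ {e : Sym2 (Fin n) | (∀ x ∈ e, x ∈ N) ∧ ¬ e.IsDiag} : BondConfig (Fin n)) ∈
        ({ω : BondConfig (Fin n) | ∀ x ∈ (↑N : Set (Fin n)), ¬ (openGraph ω).Reachable d x} ∩ openConn a b)} := by
  rintro ω ⟨hM, hab⟩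
  simp only [Set.mem_setOf_eq, Set.mem_inter_iff]
  refine ⟨fun x hx hdx => hM x hx (reachable_of_glue_of_avoids hM hdx), ?_⟩
  exact reachable_glue_mono N (show (openGraph ω).Reachable a b from hab)

/-- **Restricted comparison in the glued weighting from the unglued comparison.**  `g = K/N` (weight `1` on the non-loop pairs inside
`N`), `M = {d ↮ N}`.  If `μ_K(d ↔ b) ≤ μ_K(a ↔ b)` then `μ_g(M ∩ {d↔b}) ≤ μ_g(M ∩ {a↔b})`: Kozma–Nitzan Lemma 3(ii) in `K` (the
decreasing event `M` is read on the cluster of the weak vertex `d`), `μ_g(M ∩ {d↔b}) = μ_K(M ∩ {d↔b})` and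
`μ_K(M ∩ {a↔b}) ≤ μ_g(M ∩ {a↔b})` by the gluing push-forward.
[cite: KozmaNitzan2024, Lemma 3(ii) (pp. 6–7), §3.1 (gluing = probability 1)] -/
theorem glue_restricted_of_unglued (K : Sym2 (Fin n) → unitInterval) (N : Finset (Fin n)) (d a b : Fin n)
    (hle : (prodBernoulli K).real (openConn d b) ≤ (prodBernoulli K).real (openConn a b)) :
    (prodBernoulli (fun e' : Sym2 (Fin n) => if (∀ y ∈ e', y ∈ N) ∧ ¬ e'.IsDiag then 1 else K e')).real
        ({ω : BondConfig (Fin n) | ∀ x ∈ (↑N : Set (Fin n)), ¬ (openGraph ω).Reachable d x} ∩ openConn d b) ≤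
      (prodBernoulli (fun e' : Sym2 (Fin n) => if (∀ y ∈ e', y ∈ N) ∧ ¬ e'.IsDiag then 1 else K e')).real
        ({ω : BondConfig (Fin n) | ∀ x ∈ (↑N : Set (Fin n)), ¬ (openGraph ω).Reachable d x} ∩ openConn a b) := by
  set M : Set (BondConfig (Fin n)) :=
    {ω : BondConfig (Fin n) | ∀ x ∈ (↑N : Set (Fin n)), ¬ (openGraph ω).Reachable d x} with hM
  have hK : (prodBernoulli K).real (M ∩ openConn d b) ≤ (prodBernoulli K).real (M ∩ openConn a b) := by
    have h := KozmaNitzan2024_lemma3_ii_notConn K d a b (↑N : Set (Fin n)) hle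
    rw [Set.inter_comm (openConn d b), Set.inter_comm (openConn a b)] at h
    exact h
  rw [stub_gluePushforward n K N (M ∩ openConn d b), stub_gluePushforward n K N (M ∩ openConn a b),
    glue_preimage_avoids_inter_openConn N d b]
  exact hK.trans (measureReal_mono (glue_preimage_avoids_inter_openConn_superset N d a b))

/-! ### The peeling step -/

/-- **Peeling one contact relay.**  `g` any weighting, block `N`, `F₁` arbitrary further contact pairs, `F_a` the contact pairs at the
relay `a ∉ N` (`d ∉ N`, `d ≠ a`), `M = {d ↮ N}`, `U = ⋃_{s∈N}{s↔b}`.  If `μ_g(M ∩ {d↔b}) ≤ μ_g(M ∩ {a↔b})` and the multi-edge conclusion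
holds for `F₁` in the weighting `pinW g F_a ∅` (pairs at `a` killed), `μ(R₁ ∩ {d↔b}) ≤ μ(R₁ ∩ U)`, then
`μ_g(R ∩ {d↔b}) ≤ μ_g(R ∩ U)` for `R` = some pair of `F₁ ∪ F_a` open.  (`contact_split` over `F_a` and `contactRelay_exchange`.)
[cite: KozmaNitzan2024, Lemma 3(i)–(ii) (pp. 6–7), §3.2 pp. 12–14] -/
theorem block_multiEdge_peel (g : Sym2 (Fin n) → unitInterval) (N : Finset (Fin n)) (F₁ Fa : Finset (Sym2 (Fin n)))
    (a d b : Fin n) (hFa : ∀ e ∈ Fa, ∃ v ∈ N, e = s(v, a)) (haN : a ∉ N) (hdN : d ∉ N) (hda : d ≠ a)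
    (hrestr : (prodBernoulli g).real
        ({ω : BondConfig (Fin n) | ∀ x ∈ (↑N : Set (Fin n)), ¬ (openGraph ω).Reachable d x} ∩ openConn d b) ≤
      (prodBernoulli g).real
        ({ω : BondConfig (Fin n) | ∀ x ∈ (↑N : Set (Fin n)), ¬ (openGraph ω).Reachable d x} ∩ openConn a b))
    (hii : (prodBernoulli (pinW g (↑Fa : Set (Sym2 (Fin n))) (∅ : Set (Sym2 (Fin n))))).real
        ({ω : Set (Sym2 (Fin n)) | ∃ e ∈ F₁, e ∈ ω} ∩ openConn d b) ≤
      (prodBernoulli (pinW g (↑Fa : Set (Sym2 (Fin n))) (∅ : Set (Sym2 (Fin n))))).real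
        ({ω : Set (Sym2 (Fin n)) | ∃ e ∈ F₁, e ∈ ω} ∩ ⋃ s ∈ N, openConn s b)) :
    (prodBernoulli g).real ({ω : Set (Sym2 (Fin n)) | ∃ e ∈ F₁ ∪ Fa, e ∈ ω} ∩ openConn d b) ≤
      (prodBernoulli g).real ({ω : Set (Sym2 (Fin n)) | ∃ e ∈ F₁ ∪ Fa, e ∈ ω} ∩ ⋃ s ∈ N, openConn s b) := by
  have hB := contactRelay_exchange g N Fa a d b hFa haN hdN hda hrestr
  rw [Finset.union_comm F₁ Fa, contact_split g Fa F₁ (openConn d b), contact_split g Fa F₁ (⋃ s ∈ N, openConn s b)]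
  have hC0 : 0 ≤ (prodBernoulli g).real ({ω : Set (Sym2 (Fin n)) | ∃ e ∈ Fa, e ∈ ω}ᶜ : Set (BondConfig (Fin n))) :=
    measureReal_nonneg
  have hm := mul_le_mul_of_nonneg_left hii hC0
  linarith

end BlockPeel

end

end Summit.CriticalPhenomena.PercolationContinuityZ3.Theorems
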